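import Literature.NumberTheory.Transcendental.CyclotomicSimplexRep
import Mathlib.LinearAlgebra.Span.Basic
import HarnessLib
import Summits.KontsevichZagierPeriods.KontsevichZagierPeriods.Theorems.OctahedralSymmetryOctahedralSpanAllWeightsDefs

/-!
# Crux `OctahedralSpanAllWeights` (stmt-KontsevichZagierPeriods-9659), line `Sketch`: stub `StubElimLevelOne`

The LEVEL-ONE layer of the end case of block E (unit-pole elimination) in the two-letter normal form
argument for convergent level-4 words (route `OctahedralSymmetry`, problem `KontsevichZagierPeriods`).

## What is proved

`stub_elim_levelOne`: a convergent word `W : List (Fin 5)` over the two letters `0` (pole `1`, the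
form `dt/(t−1)`) and `4` (pole `0`, the form `dt/t`) only — a multiple zeta value up to sign — which
contains both letters lies in `rel ⊔ lowerSpan W`: modulo the relation module it is a `ℚ`-combination
of convergent words of the same length with strictly fewer letters `0`.

## How

One distribution generator suffices, in every weight.  `W` is a level-two word, so
`dilGen W = [W] − dilSubst W ∈ rel` (`IsGen.dil`), where `dilSubst W = ofTerms (expand dilLetter W)`
is the multilinear expansion of `W` under Zhao's squaring table `ω₁ ↦ ω₁ + ω₋₁` (`0 ↦ [0] + [2]`),
`ω₀ ↦ 2ω₀` (`4 ↦ 2[4]`).  For a word over `{0, 4}` this expansion is, up to the order of its terms,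
`(2^{#4(W)}, W) :: rest` where every word of `rest` has at least one letter `0` turned into `2`
(`expand_dil_perm`, induction on `W`: `expand (4 :: W) = (2c, 4V)` over `expand W = (c, V)`, and
`expand (0 :: W) = (c, 0V), (c, 2V)`).  Every expanded word has the length of `W`, at most as many
letters `0` (the letter `0` occurs only in `dilLetter 0`) and is convergent (its first letter comes from
the first letter `4` of `W`, its last letter from the last letter `0` of `W`, and `4` occurs only in
`dilLetter 4`).  Hence `dilSubst W = 2^{#4(W)} [W] + (lower words)`, so
`(2^{#4(W)} − 1) [W] ∈ rel ⊔ lowerSpan W`, and `2^{#4(W)} − 1 ≠ 0` because `#4(W) ≥ 1`.  The depth-one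
case is the classical `(1 − 2^{1−n}) ζ(n) = −Li_n(−1)`.

## Sources

J. Zhao, *Standard relations of multiple polylogarithm values at roots of unity*, Doc. Math. 15
(2010), §5 (distribution relations, the squaring map `t ↦ t²` from level 2 to level 4) [Zhao2010].
The bookkeeping of letters along the expansion is folklore; the helper lemmas on `expand` are adapted
from the landed block E1 (`StubElimGt`).
-/

noncomputable section

namespace Summit.KontsevichZagierPeriods.OctahedralSymmetry.OctaSpan

open Literature.NumberTheory.Transcendental Literature.NumberTheory.Transcendental.LevelFour

/-! ### Helper lemmas on term lists and the multilinear expansion -/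

/-- `toQ` of a term list all of whose words lie in `S` lies in the `ℚ`-span of `[V]`, `V ∈ S`
(`toQ (ofTerms L) = ∑ c • [V]`). [folklore] -/
private theorem toQ_ofTerms_mem_span {S : Set (List (Fin 5))} :
    ∀ L : List (ℤ × List (Fin 5)), (∀ p ∈ L, p.2 ∈ S) →
      toQ (ofTerms L) ∈ Submodule.span ℚ (sym '' S)
  -- adapted from `StubElimGt.toQ_ofTerms_mem_span`
  | [], _ => by simp
  | p :: L, hL => by
    rw [ofTerms_cons, map_add, toQ_single]
    have hp : sym p.2 ∈ Submodule.span ℚ (sym '' S) :=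
      Submodule.subset_span (Set.mem_image_of_mem sym (hL p (by simp)))
    exact Submodule.add_mem _ (zsmul_mem hp _)
      (toQ_ofTerms_mem_span L fun q hq => hL q (by simp [hq]))

/-- `ofTerms` does not depend on the order of the terms. [folklore] -/
private theorem ofTerms_perm {L L' : List (ℤ × List (Fin 5))} (h : L.Perm L') :
    ofTerms L = ofTerms L' :=
  (h.map _).sum_eq

/-- The words of the multilinear expansion `expand φ W` arise from `W` letter by letter: the `j`-th
letter of an expanded word is one of the letters of `φ (W j)`. [folklore] -/
private theorem forall₂_of_mem_expand (φ : Fin 5 → List (ℤ × Fin 5)) :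
    ∀ (W : List (Fin 5)) {cV : ℤ × List (Fin 5)}, cV ∈ expand φ W →
      List.Forall₂ (fun b a => b ∈ (φ a).map Prod.snd) cV.2 W
  -- adapted from `StubElimGt.forall₂_of_mem_expand`
  | [], cV, h => by
    rw [expand_nil, List.mem_singleton] at h
    subst h
    exact List.Forall₂.nil
  | m :: W, cV, h => by
    simp only [expand_cons, List.mem_flatMap, List.mem_map] at h
    obtain ⟨cb, hcb, dV, hdV, rfl⟩ := h
    exact List.Forall₂.cons (List.mem_map.2 ⟨cb, hcb, rfl⟩) (forall₂_of_mem_expand φ W hdV)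

/-- In Zhao's squaring table (`0 ↦ [0] + [2]`, `2 ↦ [1] + [3]`, `4 ↦ 2[4]`, `1, 3 ↦ 0`) the letter
`0` (pole `1`) occurs only in `dilLetter 0`. [cite: Zhao2010, §5] -/
private theorem eq_zero_of_mem_dilLetter_zero :
    ∀ a b : Fin 5, b ∈ (dilLetter a).map Prod.snd → b = 0 → a = 0 := by
  decide

/-- In Zhao's squaring table the letter `4` (pole `0`) occurs only in `dilLetter 4 = 2[4]`.
[cite: Zhao2010, §5] -/
private theorem eq_four_of_mem_dilLetter_four :
    ∀ a b : Fin 5, b ∈ (dilLetter a).map Prod.snd → b = 4 → a = 4 := by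
  decide

/-- Along the squaring expansion the number of letters `0` does not increase. [folklore] -/
private theorem count_zero_le_of_forall₂ {V W : List (Fin 5)}
    (h : List.Forall₂ (fun b a => b ∈ (dilLetter a).map Prod.snd) V W) :
    V.count 0 ≤ W.count 0 := by
  induction h with
  | nil => simp
  | @cons b a V W hba _ ih =>
    rcases eq_or_ne b 0 with rfl | hb
    · obtain rfl : a = 0 := eq_zero_of_mem_dilLetter_zero a 0 hba rfl
      rw [List.count_cons_self, List.count_cons_self]
      exact Nat.succ_le_succ ih
    · rw [List.count_cons_of_ne hb]
      exact ih.trans List.count_le_count_cons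

/-- If the letter `x` of an expanded word can only come from the letter `y` of the source and
the source does not start with `y`, the expanded word does not start with `x`. [folklore] -/
private theorem head?_ne_of_forall₂ {R : Fin 5 → Fin 5 → Prop} {x y : Fin 5}
    (hR : ∀ a b, R b a → b = x → a = y) {V W : List (Fin 5)} (h : List.Forall₂ R V W)
    (hW : W.head? ≠ some y) : V.head? ≠ some x := by
  -- adapted from `StubElimGt.head?_ne_of_forall₂`
  cases h with
  | nil => simp
  | @cons b a V W hba _ =>
    simp only [List.head?_cons, ne_eq, Option.some.injEq] at hW ⊢
    exact fun hb => hW (hR a b hba hb)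

/-- Every word of the squaring expansion of a convergent word is convergent: its first letter is
`0` only if the first letter of the source is, its last letter is `4` only if the last letter of the
source is. [cite: Zhao2010, §5] -/
private theorem isConvergent_of_forall₂_dil {V W : List (Fin 5)} (hW : IsConvergent W)
    (hF : List.Forall₂ (fun b a => b ∈ (dilLetter a).map Prod.snd) V W) : IsConvergent V := by
  refine ⟨head?_ne_of_forall₂ eq_zero_of_mem_dilLetter_zero hF hW.1, ?_⟩
  have h := head?_ne_of_forall₂ eq_four_of_mem_dilLetter_four (List.rel_reverse hF)
    (by rw [List.head?_reverse]; exact hW.2)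
  rwa [List.head?_reverse] at h

/-! ### The squaring expansion of a word over `{0, 4}` -/

/-- `dilLetter 0 = [0] + [2]` (`ω₁ ↦ ω₁ + ω₋₁` under `t ↦ t²`). [cite: Zhao2010, §5] -/
private theorem dilLetter_zero : dilLetter 0 = [(1, 0), (1, 2)] := rfl

/-- `dilLetter 4 = 2[4]` (`ω₀ ↦ 2ω₀` under `t ↦ t²`). [cite: Zhao2010, §5] -/
private theorem dilLetter_four : dilLetter 4 = [(2, 4)] := rfl

/-- One step of the expansion at a letter `0`: `expand (0 :: W) = (c, 0V), (c, 2V)` over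
`(c, V) ∈ expand W`. [cite: Zhao2010, §5] -/
private theorem expand_dil_cons_zero (W : List (Fin 5)) :
    expand dilLetter (0 :: W) =
      (expand dilLetter W).map (fun dV => (dV.1, ((0 : Fin 5) :: dV.2))) ++
        (expand dilLetter W).map (fun dV => (dV.1, ((2 : Fin 5) :: dV.2))) := by
  simp only [expand_cons, dilLetter_zero, List.flatMap_cons, List.flatMap_nil, List.append_nil,
    one_mul]

/-- One step of the expansion at a letter `4`: `expand (4 :: W) = (2c, 4V)` over
`(c, V) ∈ expand W`. [cite: Zhao2010, §5] -/
private theorem expand_dil_cons_four (W : List (Fin 5)) :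
    expand dilLetter (4 :: W) =
      (expand dilLetter W).map (fun dV => (2 * dV.1, ((4 : Fin 5) :: dV.2))) := by
  simp only [expand_cons, dilLetter_four, List.flatMap_cons, List.flatMap_nil, List.append_nil]

/-- **The squaring expansion of a word over `{0, 4}`.** Up to the order of its terms,
`expand dilLetter W = (2^{#4(W)}, W) :: rest`, where every word of `rest` has strictly fewer
letters `0` than `W` (at least one letter `0` was replaced by `2`; each letter `4` doubles the
coefficient). [cite: Zhao2010, §5] -/
private theorem expand_dil_perm : ∀ W : List (Fin 5), (∀ a ∈ W, a = 0 ∨ a = 4) →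
    ∃ rest : List (ℤ × List (Fin 5)),
      (expand dilLetter W).Perm (((2 : ℤ) ^ W.count 4, W) :: rest) ∧
        ∀ p ∈ rest, p.2.count 0 < W.count 0
  | [], _ => ⟨[], by simp, by simp⟩
  | a :: W, hab => by
    obtain ⟨rest, hperm, hrest⟩ :=
      expand_dil_perm W fun b hb => hab b (List.mem_cons_of_mem a hb)
    rcases hab a List.mem_cons_self with rfl | rfl
    · -- first letter `0`: the choice `[0]` keeps `W` in front, the choice `[2]` lowers `#0`
      refine ⟨rest.map (fun dV => (dV.1, ((0 : Fin 5) :: dV.2))) ++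
        (expand dilLetter W).map (fun dV => (dV.1, ((2 : Fin 5) :: dV.2))), ?_, ?_⟩
      · rw [expand_dil_cons_zero, List.count_cons_of_ne (by decide)]
        exact (hperm.map _).append_right _
      · intro p hp
        rcases List.mem_append.1 hp with hp | hp
        · obtain ⟨q, hq, rfl⟩ := List.mem_map.1 hp
          dsimp only
          rw [List.count_cons_self, List.count_cons_self]
          exact Nat.succ_lt_succ (hrest q hq)
        · obtain ⟨q, hq, rfl⟩ := List.mem_map.1 hp
          dsimp only
          rw [List.count_cons_of_ne (by decide), List.count_cons_self]
          exact Nat.lt_succ_of_le (count_zero_le_of_forall₂ (forall₂_of_mem_expand dilLetter W hq))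
    · -- first letter `4`: the coefficient doubles
      refine ⟨rest.map (fun dV => (2 * dV.1, ((4 : Fin 5) :: dV.2))), ?_, ?_⟩
      · rw [expand_dil_cons_four, List.count_cons_self, pow_succ']
        exact hperm.map _
      · intro p hp
        obtain ⟨q, hq, rfl⟩ := List.mem_map.1 hp
        dsimp only
        rw [List.count_cons_of_ne (by decide), List.count_cons_of_ne (by decide)]
        exact hrest q hq

/-! ### Stub E-levelOne -/

/-- **Stub E-levelOne (unit-pole elimination, level-one words; all weights).** A convergent word over
the two letters `0`, `4` only (a multiple zeta value `ζ(s₁,…,s_d)` up to sign) containing both letters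
reduces, modulo `rel`, to convergent words of the same length with fewer letters `0`: the distribution
generator `dilGen W = [W] − dilSubst W ∈ rel` (`W` is a level-two word), and
`dilSubst W = 2^{#4(W)} [W] + (words in which at least one letter 0 became 2)`, so
`(2^{#4(W)} − 1) [W]` is a combination of lower words; the classical `(1 − 2^{1−n}) ζ(n) = −Li_n(−1)`
is the depth-one case. [cite: Zhao2010, §5] -/
theorem stub_elim_levelOne (W : List (Fin 5)) (hW : IsConvergent W) (hab : ∀ a ∈ W, a = 0 ∨ a = 4)
    (h0 : 0 < W.count 0) (h4 : 0 < W.count 4) : sym W ∈ rel ⊔ lowerSpan W := by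
  have _ := h0 -- implied by the other hypotheses (a convergent word over `{0, 4}` with a letter `4`
  -- is nonempty and ends in `0`); the one-generator argument below does not need it
  obtain ⟨rest, hperm, hrest⟩ := expand_dil_perm W hab
  -- the distribution generator of the level-two word `W`
  have h2 : IsLevelTwo W := fun a ha => (hab a ha).elim Or.inl fun h => Or.inr (Or.inr h)
  have hgen : sym W - toQ (dilSubst W) ∈ rel := mem_rel_of_isGen (IsGen.dil hW h2)
  -- `dilSubst W = 2^{#4(W)} [W] + (the terms of `rest`)`
  have hdil : toQ (dilSubst W) = (2 : ℚ) ^ W.count 4 • sym W + toQ (ofTerms rest) := by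
    rw [dilSubst, ofTerms_perm hperm, ofTerms_cons, map_add, toQ_single, ← Int.cast_smul_eq_zsmul ℚ,
      Int.cast_pow, Int.cast_ofNat]
  -- every word of `rest` is a lower word
  have hlow : toQ (ofTerms rest) ∈ lowerSpan W := by
    unfold lowerSpan
    refine toQ_ofTerms_mem_span rest fun p hp => ?_
    have hpW : p ∈ expand dilLetter W := hperm.symm.subset (List.mem_cons_of_mem _ hp)
    have hF := forall₂_of_mem_expand dilLetter W hpW
    exact ⟨hF.length_eq, isConvergent_of_forall₂_dil hW hF, hrest p hp⟩
  -- `(2^{#4(W)} − 1) • [W] = −dilGen W − rest`, and the scalar is invertible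
  have hc : (2 : ℚ) ^ W.count 4 - 1 ≠ 0 :=
    sub_ne_zero.2 (one_lt_pow₀ (by norm_num : (1 : ℚ) < 2) h4.ne').ne'
  have hmem : ((2 : ℚ) ^ W.count 4 - 1) • sym W ∈ rel ⊔ lowerSpan W := by
    have heq : ((2 : ℚ) ^ W.count 4 - 1) • sym W =
        -(sym W - toQ (dilSubst W)) - toQ (ofTerms rest) := by
      rw [hdil, sub_smul, one_smul]
      abel
    rw [heq]
    exact Submodule.sub_mem _ (Submodule.neg_mem _ (Submodule.mem_sup_left hgen))
      (Submodule.mem_sup_right hlow)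
  exact (Submodule.smul_mem_iff _ hc).1 hmem

end Summit.KontsevichZagierPeriods.OctahedralSymmetry.OctaSpan

end
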